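import Summits.ValiantsHypothesis.ValiantsHypothesis.Theorems.LacunarySymmetroidMatrixDescartesDoorA26WallBubblingNullEndTwenty
import Summits.ValiantsHypothesis.ValiantsHypothesis.Theorems.LacunarySymmetroidMatrixDescartesDoorA26WallBubblingBubblingAssembly

/-!
# Wall bubbling for `DoorA26` — obligation (R), END profiles read positively, part 3: the cluster-limit currency (`Realisable` Gram vectors)

HONEST FRAMING.  Helper theorems for the line `Cruxes/DoorA26/Lines/wall_bubbling.lean` (crux stmt-ValiantsHypothesis-19979 `DoorA26`; OPEN, typed,
never asserted), W2 seat val-sym-door-p1 g16; obligation (R).  Def-free; nothing here bears on `DoorA26`, `MatrixDescartes` (stmt-ValiantsHypothesis-18050)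
or `VP ≠ VNP`; registers unchanged.

CONTENT.  Part 2 (`…WallBubblingNullEndTwenty.lean`) is stated for LETTERS `S`.  A `Bubbling.ClusterLimit` carries, per cluster `c`, a limit coefficient vector
`H c : Pair → ℝ` with `Realisable (Matrix.of fun k l => H c (k, l))` and the limit function `expSum (H c) (pairExp δ⋆)`.  This file transports part 2 to that
currency: `expSum H (pairExp δ) t = ε · det Σ_l e^{δ_l t} S_l` for the realising letters (`expSum_eq_eps_mul_det_of_realisable`), products of two values are
insensitive to `ε = ±1`, a dead bottom member `H (0,0) = 0` with an alive member `H (0,k) ≠ 0` makes `S₀` null and non-zero (hence `tr S₀ ≠ 0`), and so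
**`mem_twentyLocus_of_realisable_nullBot_alternations`**: `StrictMono δ`, `H` realisable, `H (0,0) = 0`, `H (0,k) ≠ 0` for some `k`, and `20` increasing
abscissae with alternating non-zero values of `expSum H (pairExp δ)` ⇒ `δ ∈ TwentyLocus`; mirror `…nullTop…` (`H (5,5) = 0`, some `H (k,5) ≠ 0`) and
`…nullNull…` (both, `19` abscissae).  These are the forms the (R) discharger applies to the big cluster of a `(1,19)` / `(19,1)` / `(1,18,1)` END profile when
its limit zeros are simple.

[folklore] bookkeeping; [this work] the wiring.
-/

-- `Summit.ValiantsHypothesis.ValiantsHypothesis.…` repeats a component by the D-0017 layout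
-- (single-conjunct summit), which the `dupNamespace` linter flags; the name is mandated.
set_option linter.dupNamespace false

namespace Summit.ValiantsHypothesis.ValiantsHypothesis.Theorems.LacunarySymmetroidMatrixDescartes.WallBubbling

open Finset Filter Topology
open Bubbling (polar polar_self expSum Pair pairExp Realisable TwentyLocus det_pencil_exp rpow_exp_eq)

/-! ## §1 Realisable Gram vectors are `±` pencil determinants -/

/-- For realising letters `S` with sign `ε`, `expSum H (pairExp δ) t = ε · det Σ_l e^{δ_l t} S_l`. [this work] -/
theorem expSum_eq_eps_mul_det (δ : Fin 6 → ℝ) (H : Pair → ℝ) (ε : ℝ) (S : Fin 6 → Matrix (Fin 2) (Fin 2) ℝ)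
    (hH : ∀ i j, H (i, j) = ε * polar (S i) (S j)) (t : ℝ) :
    expSum H (pairExp δ) t = ε * (∑ l, Real.exp (δ l * t) • S l).det := by
  have hS : (∑ l, Real.exp (δ l * t) • S l) = ∑ l, ((Real.exp t) ^ (δ l)) • S l := by
    refine Finset.sum_congr rfl fun l _ => ?_
    rw [rpow_exp_eq]
  rw [hS, det_pencil_exp]
  unfold expSum
  rw [Finset.mul_sum]
  refine Finset.sum_congr rfl fun p _ => ?_
  obtain ⟨i, j⟩ := p
  rw [hH i j]
  ring

/-- Unpacking `Realisable`: letters, a sign `ε` with `ε * ε = 1`, and the entrywise identity. [this work] -/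
theorem exists_letters_of_realisable (H : Pair → ℝ) (hreal : Realisable (Matrix.of fun k l => H (k, l))) :
    ∃ (ε : ℝ) (S : Fin 6 → Matrix (Fin 2) (Fin 2) ℝ), ε * ε = 1 ∧ (∀ l, (S l).IsSymm) ∧ ∀ i j, H (i, j) = ε * polar (S i) (S j) := by
  obtain ⟨ε, S, hε, hS, hG⟩ := hreal
  refine ⟨ε, S, ?_, hS, fun i j => ?_⟩
  · rcases hε with h | h <;> subst h <;> norm_num
  · have := hG i j
    simpa [Matrix.of_apply] using this

/-- A dead diagonal member and an alive member in the same row make that letter NULL and NON-ZERO. [this work] -/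
theorem null_nonzero_of_members {H : Pair → ℝ} {ε : ℝ} {S : Fin 6 → Matrix (Fin 2) (Fin 2) ℝ} (hε : ε * ε = 1)
    (hH : ∀ i j, H (i, j) = ε * polar (S i) (S j)) {i k : Fin 6} (hii : H (i, i) = 0) (hik : H (i, k) ≠ 0) :
    (S i).det = 0 ∧ S i ≠ 0 := by
  have hε0 : ε ≠ 0 := by
    intro h; rw [h, zero_mul] at hε; exact zero_ne_one hε
  refine ⟨?_, ?_⟩
  · have := hH i i
    rw [hii, polar_self] at this
    rcases mul_eq_zero.mp this.symm with h | h
    · exact (hε0 h).elim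
    · exact h
  · intro hSi
    apply hik
    have hz : polar 0 (S k) = 0 := by unfold polar; simp
    rw [hH i k, hSi, hz, mul_zero]

/-- Alternation of `expSum` values transfers to alternation of determinant values (`ε² = 1`). [this work] -/
theorem det_alternations_of_expSum_alternations (δ : Fin 6 → ℝ) (H : Pair → ℝ) (ε : ℝ) (S : Fin 6 → Matrix (Fin 2) (Fin 2) ℝ)
    (hε : ε * ε = 1) (hH : ∀ i j, H (i, j) = ε * polar (S i) (S j)) {N : ℕ} (τ : Fin (N + 1) → ℝ)
    (halt : ∀ j : Fin N, expSum H (pairExp δ) (τ j.castSucc) * expSum H (pairExp δ) (τ j.succ) < 0) :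
    ∀ j : Fin N, (∑ l, Real.exp (δ l * τ j.castSucc) • S l).det * (∑ l, Real.exp (δ l * τ j.succ) • S l).det < 0 := by
  intro j
  have h := halt j
  rw [expSum_eq_eps_mul_det δ H ε S hH, expSum_eq_eps_mul_det δ H ε S hH] at h
  have : ε * (∑ l, Real.exp (δ l * τ j.castSucc) • S l).det * (ε * (∑ l, Real.exp (δ l * τ j.succ) • S l).det)
      = (ε * ε) * ((∑ l, Real.exp (δ l * τ j.castSucc) • S l).det * (∑ l, Real.exp (δ l * τ j.succ) • S l).det) := by ring
  rw [this, hε, one_mul] at h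
  exact h

/-! ## §2 Membership in the twenty-locus, cluster-limit currency -/

/-- **(1,19) END profile, realisable currency.**  `StrictMono δ`, `H` realisable with the bottom diagonal member dead (`H (0,0) = 0`) and some member of
row `0` alive, and `20` increasing abscissae with alternating non-zero values of `expSum H (pairExp δ)` ⇒ `δ ∈ TwentyLocus`. [this work] -/
theorem mem_twentyLocus_of_realisable_nullBot_alternations (δ : Fin 6 → ℝ) (hd : StrictMono δ) (H : Pair → ℝ)
    (hreal : Realisable (Matrix.of fun k l => H (k, l))) (h00 : H (0, 0) = 0) (h0k : ∃ k, H (0, k) ≠ 0)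
    (τ : Fin 20 → ℝ) (hτ : StrictMono τ)
    (halt : ∀ j : Fin 19, expSum H (pairExp δ) (τ j.castSucc) * expSum H (pairExp δ) (τ j.succ) < 0) :
    δ ∈ TwentyLocus := by
  obtain ⟨ε, S, hε, hS, hH⟩ := exists_letters_of_realisable H hreal
  obtain ⟨k, hk⟩ := h0k
  obtain ⟨hdet, hne⟩ := null_nonzero_of_members hε hH h00 hk
  exact mem_twentyLocus_of_nullBot_alternations δ hd S hS hdet
    (LacunarySymmetroidMatrixDescartes.TailGraft.trace_ne_zero_of_det_eq_zero (hS 0) hdet hne) τ hτ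
    (det_alternations_of_expSum_alternations δ H ε S hε hH τ halt)

/-- **(19,1) END profile, realisable currency** (top diagonal member dead, some member of column `5` alive). [this work] -/
theorem mem_twentyLocus_of_realisable_nullTop_alternations (δ : Fin 6 → ℝ) (hd : StrictMono δ) (H : Pair → ℝ)
    (hreal : Realisable (Matrix.of fun k l => H (k, l))) (h55 : H (5, 5) = 0) (h5k : ∃ k, H (5, k) ≠ 0)
    (τ : Fin 20 → ℝ) (hτ : StrictMono τ)
    (halt : ∀ j : Fin 19, expSum H (pairExp δ) (τ j.castSucc) * expSum H (pairExp δ) (τ j.succ) < 0) :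
    δ ∈ TwentyLocus := by
  obtain ⟨ε, S, hε, hS, hH⟩ := exists_letters_of_realisable H hreal
  obtain ⟨k, hk⟩ := h5k
  obtain ⟨hdet, hne⟩ := null_nonzero_of_members hε hH h55 hk
  exact mem_twentyLocus_of_nullTop_alternations δ hd S hS hdet
    (LacunarySymmetroidMatrixDescartes.TailGraft.trace_ne_zero_of_det_eq_zero (hS 5) hdet hne) τ hτ
    (det_alternations_of_expSum_alternations δ H ε S hε hH τ halt)

/-- **(1,18,1) END profile, realisable currency** (both end diagonal members dead, rows `0` and `5` each with an alive member, `19` abscissae). [this work] -/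
theorem mem_twentyLocus_of_realisable_nullNull_alternations (δ : Fin 6 → ℝ) (hd : StrictMono δ) (H : Pair → ℝ)
    (hreal : Realisable (Matrix.of fun k l => H (k, l))) (h00 : H (0, 0) = 0) (h0k : ∃ k, H (0, k) ≠ 0)
    (h55 : H (5, 5) = 0) (h5k : ∃ k, H (5, k) ≠ 0)
    (τ : Fin 19 → ℝ) (hτ : StrictMono τ)
    (halt : ∀ j : Fin 18, expSum H (pairExp δ) (τ j.castSucc) * expSum H (pairExp δ) (τ j.succ) < 0) :
    δ ∈ TwentyLocus := by
  obtain ⟨ε, S, hε, hS, hH⟩ := exists_letters_of_realisable H hreal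
  obtain ⟨k, hk⟩ := h0k
  obtain ⟨k', hk'⟩ := h5k
  obtain ⟨hdet0, hne0⟩ := null_nonzero_of_members hε hH h00 hk
  obtain ⟨hdet5, hne5⟩ := null_nonzero_of_members hε hH h55 hk'
  exact mem_twentyLocus_of_nullNull_alternations δ hd S hS hdet0
    (LacunarySymmetroidMatrixDescartes.TailGraft.trace_ne_zero_of_det_eq_zero (hS 0) hdet0 hne0) hdet5
    (LacunarySymmetroidMatrixDescartes.TailGraft.trace_ne_zero_of_det_eq_zero (hS 5) hdet5 hne5) τ hτ
    (det_alternations_of_expSum_alternations δ H ε S hε hH τ halt)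

end Summit.ValiantsHypothesis.ValiantsHypothesis.Theorems.LacunarySymmetroidMatrixDescartes.WallBubbling
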